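import Literature.AlgebraicGeometry.Resolution.AlterationsFormalNodesHolds
import Literature.AlgebraicGeometry.Resolution.AlterationsCodimThreeModificationLeaves
import Literature.AlgebraicGeometry.Resolution.AlterationsFormalNodesPresentation
import Literature.AlgebraicGeometry.Resolution.AlterationsCodimThreeNodalFormPartsProofs
import Literature.AlgebraicGeometry.Resolution.AlterationsNodalBoundary
import HarnessLib

/-!
# De Jong 1996, 3.3 / 3.5 / 4.24–4.28: the discharges downstream of `DeJong1996SplitNodalStructure`

Topic: `Literature/AlgebraicGeometry/Resolution`. With 2.23 + 3.3 in the split case proved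
(`DeJong1996SplitNodalStructure_holds`, `AlterationsFormalNodesHolds.lean`), the tree's
assemblies along the printed proof close the following named facts (pure composition, no new
statement, no definition; each proved from its assembly, cited at the assembly):

* `DeJong1996SemiStableBoundaryNormalCrossingsSingF`, `DeJong1996SemiStableBoundaryNormalCrossings`
  (4.24 [B2] / 4.25 (i) at the closed points, `AlterationsBoundarySmoothLocus.lean`,
  `AlterationsIsNormalFormParts.lean`) — `….of_splitNodalStructure`
  (`AlterationsFormalNodesRegular.lean`);
* `DeJong1996SemiStableNodalPresentation` (the presentation of 3.3 with `Σ nᵢ ≥ 2` at the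
  singular closed points, `AlterationsCodimThreeNodalFormParts.lean`) — `….of_splitNodalStructure`
  (`AlterationsFormalNodesPresentation.lean`);
* `DeJong1996CodimThreeNodalForm` (4.25 (ii), `AlterationsIsNormalFormParts.lean`) —
  `….of_splitNodal_of_boundary_of_exponents` with `DeJong1996SemiStableNodalBoundary_holds` and
  `DeJong1996CodimThreeExponentsLeOne_holds`;
* `DeJong1996CodimThreeSingularComponentsFormal`, `DeJong1996CodimThreeSingularComponentsRegular`
  (3.5 [B5], `AlterationsSingularComponents.lean`, `AlterationsIsNormalFormParts.lean`) —
  `….of_splitNodal_of_polynomial` with `Matsumura1987_32_polynomial_holds` (Mizutani);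
* `DeJong1996SemiStablePairIsNormalForm` (3.5 with 4.24, `AlterationsNormalFormBlowup.lean`) —
  `….of_parts` with [B1] `DeJong1996SemiStableBoundaryIsDivisor_holds`;
* `DeJong1996CodimThreeModification` (3.5/4.25–4.28, first sentence,
  `AlterationsSemiStableResolution.lean`) — `….of_isNormalForm_of_blowup_of_formal` with
  Claim 4.27 `DeJong1996NormalFormPairBlowup_holds`, `DeJong1996FormalNormalCrossings_holds` and
  `BlowupProjectiveOverField_holds`.

## Sources

* A. J. de Jong, *Smoothness, semi-stability and alterations*, Publ. Math. IHÉS 83 (1996) 51–93: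
  2.23, 3.3–3.5 (pp. 61–64), 4.24–4.28 (pp. 75–76). [DeJong1996]
-/

noncomputable section

namespace Literature.AlgebraicGeometry.Resolution

universe u

/-- **de Jong 1996, 4.25 (i) at the regular closed points of `Sing(f)`
(`DeJong1996SemiStableBoundaryNormalCrossingsSingF`) — PROVED.** [cite: DeJong1996, 4.25 (i), p. 75] -/
theorem DeJong1996SemiStableBoundaryNormalCrossingsSingF_holds :
    DeJong1996SemiStableBoundaryNormalCrossingsSingF.{u} :=
  DeJong1996SemiStableBoundaryNormalCrossingsSingF.of_splitNodalStructure
    DeJong1996SplitNodalStructure_holds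

/-- **de Jong 1996, 4.24 [B2] / 4.25 (i) (`DeJong1996SemiStableBoundaryNormalCrossings`) —
PROVED.** [cite: DeJong1996, 4.24–4.25 (i), p. 75] -/
theorem DeJong1996SemiStableBoundaryNormalCrossings_holds :
    DeJong1996SemiStableBoundaryNormalCrossings.{u} :=
  DeJong1996SemiStableBoundaryNormalCrossings.of_splitNodalStructure DeJong1996SplitNodalStructure_holds

/-- **de Jong 1996, 3.3 with "`Σ nᵢ ≥ 2`" at the singular closed points
(`DeJong1996SemiStableNodalPresentation`) — PROVED.** [cite: DeJong1996, 3.3, p. 63] -/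
theorem DeJong1996SemiStableNodalPresentation_holds : DeJong1996SemiStableNodalPresentation.{u} :=
  DeJong1996SemiStableNodalPresentation.of_splitNodalStructure DeJong1996SplitNodalStructure_holds

/-- **de Jong 1996, 4.25 (ii) (`DeJong1996CodimThreeNodalForm`) — PROVED.**
[cite: DeJong1996, 4.25 (ii), p. 75] -/
theorem DeJong1996CodimThreeNodalForm_holds : DeJong1996CodimThreeNodalForm.{u} :=
  DeJong1996CodimThreeNodalForm.of_splitNodal_of_boundary_of_exponents
    DeJong1996SplitNodalStructure_holds DeJong1996SemiStableNodalBoundary_holds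
    DeJong1996CodimThreeExponentsLeOne_holds

/-- **de Jong 1996, 3.5 [B5], formal form (`DeJong1996CodimThreeSingularComponentsFormal`) —
PROVED.** [cite: DeJong1996, 3.5, p. 64] -/
theorem DeJong1996CodimThreeSingularComponentsFormal_holds :
    DeJong1996CodimThreeSingularComponentsFormal.{u} :=
  DeJong1996CodimThreeSingularComponentsFormal.of_splitNodal_of_polynomial
    DeJong1996SplitNodalStructure_holds Matsumura1987_32_polynomial_holds

/-- **de Jong 1996, 3.5 [B5]: the components of the singular locus are regular
(`DeJong1996CodimThreeSingularComponentsRegular`) — PROVED.** [cite: DeJong1996, 3.5, p. 64] -/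
theorem DeJong1996CodimThreeSingularComponentsRegular_holds :
    DeJong1996CodimThreeSingularComponentsRegular.{u} :=
  DeJong1996CodimThreeSingularComponentsRegular.of_formal
    DeJong1996CodimThreeSingularComponentsFormal_holds

/-- **de Jong 1996, 3.5 with 4.24: a pair in Situation 4.23 with `codim(Sing X) ≥ 3` is in
Situation 4.25 (`DeJong1996SemiStablePairIsNormalForm`) — PROVED** from its four parts
[B1] `DeJong1996SemiStableBoundaryIsDivisor_holds`, [B2], 4.25 (ii) and [B5] above.
[cite: DeJong1996, 3.5 and 4.24–4.25, pp. 64, 75] -/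
theorem DeJong1996SemiStablePairIsNormalForm_holds : DeJong1996SemiStablePairIsNormalForm.{u} :=
  DeJong1996SemiStablePairIsNormalForm.of_parts DeJong1996SemiStableBoundaryIsDivisor_holds
    DeJong1996SemiStableBoundaryNormalCrossings_holds DeJong1996CodimThreeNodalForm_holds
    DeJong1996CodimThreeSingularComponentsRegular_holds

/-- **de Jong 1996, 3.5/4.25–4.28, first sentence (`DeJong1996CodimThreeModification`) —
PROVED**: 3.5 puts the pair in Situation 4.25, and the 4.28 iteration of the blow-ups of
Claim 4.27 (`DeJong1996NormalFormPairBlowup_holds`) gives the projective modification with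
nonsingular source and normal crossings boundary (`DeJong1996FormalNormalCrossings_holds`,
`BlowupProjectiveOverField_holds`). [cite: DeJong1996, 3.5 and 4.24–4.28, pp. 64, 75–76] -/
theorem DeJong1996CodimThreeModification_holds : DeJong1996CodimThreeModification.{u} :=
  DeJong1996CodimThreeModification.of_isNormalForm_of_blowup_of_formal
    DeJong1996SemiStablePairIsNormalForm_holds DeJong1996NormalFormPairBlowup_holds
    DeJong1996FormalNormalCrossings_holds BlowupProjectiveOverField_holds

end Literature.AlgebraicGeometry.Resolution

end
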